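import Literature.Probability.LatticeModels.DobrushinShlosmanWindowDusting
import Literature.Probability.LatticeModels.ONModelDobrushinStates
import HarnessLib

/-!
# The Dobrushin–Shlosman window comparison in INFINITE volume: boundary insensitivity of the
# finite-volume kernels and uniqueness of the Gibbs measure

Topic `Literature/Probability/LatticeModels`; theorems only (no definitions, no named facts).

The tree's Dobrushin–Shlosman window comparison theorem (`DobrushinShlosman.abs_sub_le_exp`,
Dobrushin–Shlosman 1985 in the Vasserstein / Kantorovich–Rubinstein form, `DobrushinShlosmanContraction.lean`)
is stated for a FINITE cell type. This file draws its two classical INFINITE-VOLUME consequences for a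
general specification `γ` on `V → S` (`V` arbitrary, e.g. the links of `ℤ^d`) whose WINDOW kernels
`γ_{win c}(· | η)` (one finite window `win c ∋ c` per centre `c : V`, every site in at most `N⋆` windows)
satisfy, for a bounded site weight `0 ≤ r ≤ R`,

* **(H1)** the one-boundary-site vector Kantorovich contraction with array `K c y x ≥ 0`
  (hypothesis `hcontract`, verbatim the finite-volume one with cells = sites),
* **(H2)** the PER-WINDOW received-sum bound `Σ_y K c y x ≤ γ₀ < 1` for every `x ∈ win c`
  (Dobrushin–Shlosman's condition `C_V`, vector form),
* **locality**: on window-local test functions the window kernel reads the boundary condition only on a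
  finite set `nbhd c ⊇ win c` carrying the support of `K c · x` (finite range).

Results:

* `abs_integral_sub_integral_le_of_window` — **exponential insensitivity to the boundary condition**
  (Dobrushin–Shlosman 1985, Theorem, the exponential estimate behind uniqueness; Dobrushin–Shlosman 1987,
  §2, condition IIIc): for every finite volume `Λ`, any two boundary conditions `ω, η`, and every bounded
  measurable `Λ`-local `F` whose site-Lipschitz vector `δ` vanishes below level `L₀` of a profile `ℓ` adapted
  to `Λ` (windows around sites of positive profile lie inside `Λ` together with their locality sets; `ℓ`
  drops by at most one along the support of `K`), `|γ_Λ F(ω) − γ_Λ F(η)| ≤ 2 R e^{−κ₁ L₀} Σ_{x ∈ Λ} δ x`,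
  `κ₁ = (1−γ₀)²/(2(2γ₀N⋆+1))`.
  PROOF: the finite-cell theorem on the cell type `↥Λ` with the two kernels as the two functionals; centres
  whose locality set lies inside `Λ` act by their window kernel (exterior frozen to `ω`; usable for BOTH
  functionals by consistency + locality), the remaining centres act by freezing their own site (window
  `{c}`, array `0`, never usable) — so the received sums over `↥Λ` are bounded by the per-window bound.
* `integral_eq_integral_of_window`, `subsingleton_gibbsMeasures_of_window` — **uniqueness of the Gibbs
  measure** (Dobrushin–Shlosman 1985, Theorem 1: `C_V` ⇒ uniqueness; here in the Vasserstein form for an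
  arbitrary measurable spin space): if every finite `Δ` admits, for every `L₀`, a finite `Λ ⊇ Δ` with an
  adapted profile `≥ L₀` on `Δ` (an exhaustion; on `ℤ^d` with bounded windows: balls), then any two Gibbs
  measures agree on bounded local Lipschitz observables (DLR: `μ F − ν F = ∫∫ (γ_Λ F(ω) − γ_Λ F(η)) dμ dν`),
  hence coincide when such observables determine the measure
  (`DobrushinMetric.measure_eq_of_forall_integral_eq_of_isLipBound`).

References: R. L. Dobrushin, S. B. Shlosman, *Constructive criterion for the uniqueness of Gibbs field*, in:
Statistical Physics and Dynamical Systems (Birkhäuser 1985) 347–370, Thm. 1 and §2; *Completely analytical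
interactions: constructive description*, J. Stat. Phys. 46 (1987) 983–1014, §2 conditions III; H. Föllmer,
LNM 1362 (1988) Ch. I (2.7)–(2.10); H.-O. Georgii, *Gibbs Measures and Phase Transitions* (2011) Thm. 8.7,
§8.2; the tree files `DobrushinShlosmanContraction.lean`, `DobrushinShlosmanWindowDusting.lean`,
`DobrushinMetricStates.lean`.
-/

noncomputable section

open MeasureTheory ProbabilityTheory Finset Function
open Literature.Probability.LatticeModels.DobrushinMetric (IsLipBound integrable_of_abs_le'
  abs_sub_le_mul_sum_of_dependsOn measure_eq_of_forall_integral_eq_of_isLipBound)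

namespace Literature.Probability.LatticeModels.DobrushinShlosman

variable {V S : Type*} [MeasurableSpace S]

/-! ### Small measure-theoretic helpers -/

/-- Freezing one coordinate to a constant is measurable. [folklore] -/
private theorem measurable_update_const' [DecidableEq V] (y : V) (a : S) :
    Measurable fun σ : V → S => Function.update σ y a := by
  refine measurable_pi_iff.2 fun z => ?_
  by_cases hz : z = y
  · subst hz
    simp only [Function.update_self]
    exact measurable_const
  · simp only [Function.update_of_ne hz]
    exact measurable_pi_apply z

/-- Two averages, under two probability measures, of a bounded measurable function with oscillation `≤ A`
differ by at most `A`. [folklore] -/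
private theorem abs_integral_sub_integral_le_of_osc' {μ ν : Measure (V → S)} [IsProbabilityMeasure μ]
    [IsProbabilityMeasure ν] {h : (V → S) → ℝ} (hm : Measurable h) {B : ℝ} (hB : ∀ σ, |h σ| ≤ B)
    {A : ℝ} (hosc : ∀ σ τ, |h σ - h τ| ≤ A) :
    |(∫ σ, h σ ∂μ) - ∫ τ, h τ ∂ν| ≤ A := by
  -- adapted from `DobrushinMetric.abs_integral_sub_integral_le_of_osc` (private in the tree)
  have hiμ : Integrable h μ := integrable_of_abs_le' hm hB
  have hiν : Integrable h ν := integrable_of_abs_le' hm hB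
  have hpt : ∀ σ, |h σ - ∫ τ, h τ ∂ν| ≤ A := fun σ => by
    have e : h σ - ∫ τ, h τ ∂ν = ∫ τ, (h σ - h τ) ∂ν := by
      rw [integral_sub (integrable_const _) hiν, integral_const, smul_eq_mul, probReal_univ, one_mul]
    rw [e]
    calc |∫ τ, (h σ - h τ) ∂ν| ≤ ∫ τ, |h σ - h τ| ∂ν := abs_integral_le_integral_abs
      _ ≤ ∫ _τ, A ∂ν := integral_mono ((integrable_const _).sub hiν).abs (integrable_const A)
          fun τ => hosc σ τ
      _ = A := by simp
  have e : (∫ σ, h σ ∂μ) - ∫ τ, h τ ∂ν = ∫ σ, (h σ - ∫ τ, h τ ∂ν) ∂μ := by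
    rw [integral_sub hiμ (integrable_const _), integral_const, smul_eq_mul, probReal_univ, one_mul]
  rw [e]
  calc |∫ σ, (h σ - ∫ τ, h τ ∂ν) ∂μ| ≤ ∫ σ, |h σ - ∫ τ, h τ ∂ν| ∂μ := abs_integral_le_integral_abs
    _ ≤ ∫ _σ, A ∂μ := integral_mono (hiμ.sub (integrable_const _)).abs (integrable_const A) hpt
    _ = A := by simp

/-! ### Locality of a window kernel makes the frozen exterior invisible -/

/-- **A local window kernel does not see a change of the boundary condition off its locality set, on
observables local in a larger volume.** If on window-local test functions the kernel `γ_W(· | ζ)` depends on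
`ζ` only through the sites of `T`, then for every bounded measurable `F` depending only on the sites of a
finite `Λ ⊇ T` and all `ζ, ζ'` agreeing on `Λ`: `∫ F dγ_W(· | ζ) = ∫ F dγ_W(· | ζ')` (properness reduces `F` to
the window-local `F(·_W ζ_{Wᶜ}) = F(·_W ζ'_{Wᶜ})`). [cite: Georgii2011, Def. 1.23] -/
theorem windowAvg_congr_of_local [DecidableEq V] {γ : Specification V S} (hγ : IsSpecification γ)
    {W T Λ : Finset V} (hTΛ : T ⊆ Λ)
    (hloc : ∀ (ζ ζ' : V → S), (∀ v ∈ T, ζ v = ζ' v) →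
      ∀ (f : (V → S) → ℝ), Measurable f → (∃ B, ∀ σ, |f σ| ≤ B) → DependsOn f (W : Set V) →
        ∫ σ, f σ ∂(γ W ζ) = ∫ σ, f σ ∂(γ W ζ'))
    {F : (V → S) → ℝ} (hFm : Measurable F) {B : ℝ} (hB : ∀ σ, |F σ| ≤ B)
    (hFdep : DependsOn F (Λ : Set V)) {ζ ζ' : V → S} (hζ : ∀ v ∈ Λ, ζ v = ζ' v) :
    ∫ σ, F σ ∂(γ W ζ) = ∫ σ, F σ ∂(γ W ζ') := by
  -- the window-local transport of `F`
  set ψ : (V → S) → ℝ := fun σ => F (W.piecewise σ ζ') with hψ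
  have hψm : Measurable ψ := hFm.comp (measurable_piecewise_conf W ζ')
  have hψB : ∃ B, ∀ σ, |ψ σ| ≤ B := ⟨B, fun σ => hB _⟩
  have hψdep : DependsOn ψ (W : Set V) := by
    intro σ σ' hσ
    simp only [hψ]
    congr 1
    funext v
    by_cases hv : v ∈ W
    · rw [Finset.piecewise_eq_of_mem _ _ _ hv, Finset.piecewise_eq_of_mem _ _ _ hv]
      exact hσ v (Finset.mem_coe.2 hv)
    · rw [Finset.piecewise_eq_of_notMem _ _ _ hv, Finset.piecewise_eq_of_notMem _ _ _ hv]
  -- under `γ_W(· | ζ)` the observable `F` is `ψ` (properness + `F` reads only `Λ`, where `ζ = ζ'`)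
  have h1 : ∫ σ, F σ ∂(γ W ζ) = ∫ σ, ψ σ ∂(γ W ζ) := by
    rw [windowAvg_eq_integral_piecewise hγ W F ζ]
    refine integral_congr_ae (ae_of_all _ fun σ => ?_)
    simp only [hψ]
    refine hFdep fun v hv => ?_
    by_cases hvW : v ∈ W
    · rw [Finset.piecewise_eq_of_mem _ _ _ hvW, Finset.piecewise_eq_of_mem _ _ _ hvW]
    · rw [Finset.piecewise_eq_of_notMem _ _ _ hvW, Finset.piecewise_eq_of_notMem _ _ _ hvW]
      exact hζ v (Finset.mem_coe.1 hv)
  have h2 : ∫ σ, F σ ∂(γ W ζ') = ∫ σ, ψ σ ∂(γ W ζ') := by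
    rw [windowAvg_eq_integral_piecewise hγ W F ζ']
  rw [h1, h2]
  exact hloc ζ ζ' (fun v hv => hζ v (hTΛ hv)) ψ hψm hψB hψdep

/-! ### Exponential insensitivity of the finite-volume kernels to the boundary condition -/

/-- **Dobrushin–Shlosman: the finite-volume kernels forget the boundary condition exponentially fast in the
depth** (Dobrushin–Shlosman 1985, Theorem; 1987, §2: the constructive window condition implies exponential
decay of the boundary influence — here in the Vasserstein form, for an arbitrary measurable spin space and an
arbitrary index set `V`). Data: a specification `γ` on `V → S`; a site weight `0 ≤ r ≤ R`; windows `win c ∋ c`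
with locality sets `nbhd c ⊇ win c`; an array `K ≥ 0` supported in `y ∈ nbhd c` with the one-boundary-site
window contraction (H1) `hcontract`, the locality `hloc` of the window kernels, the PER-WINDOW received-sum
bound (H2) `Σ_{y ∈ nbhd c} K c y x ≤ γ₀ < 1` (`x ∈ win c`), and at most `N⋆` windows around any site. Then for
a finite volume `Λ`, boundary conditions `ω, η`, a profile `ℓ : V → ℕ` such that every window around a site of
positive profile has its centre and locality set inside `Λ` and `ℓ` drops by at most one from `x ∈ win c` to a
site `y` with `K c y x ≠ 0`, and a bounded measurable `F` reading only `Λ` with site-Lipschitz vector `δ`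
vanishing where `ℓ < L₀`:
`|∫ F dγ_Λ(·|ω) − ∫ F dγ_Λ(·|η)| ≤ 2 R e^{−(1−γ₀)² L₀/(2(2γ₀N⋆+1))} Σ_{x ∈ Λ} δ x`.
[cite: DobrushinShlosman1985, Theorem 1] -/
theorem abs_integral_sub_integral_le_of_window [DecidableEq V] {γ : Specification V S}
    (hγ : IsSpecification γ)
    {r : S → S → ℝ} {R : ℝ} (hr0 : ∀ a b, 0 ≤ r a b) (hrR : ∀ a b, r a b ≤ R) (hR : 0 ≤ R)
    {win nbhd : V → Finset V} {K : V → V → V → ℝ} (hK0 : ∀ c y x, 0 ≤ K c y x)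
    (hself : ∀ c, c ∈ win c) (hwin : ∀ c, win c ⊆ nbhd c)
    (hKsupp : ∀ c y x, K c y x ≠ 0 → y ∈ nbhd c)
    (hcontract : ∀ (c y : V), y ∉ win c → ∀ (ω η : V → S), (∀ v, v ≠ y → ω v = η v) →
      ∀ (f : (V → S) → ℝ) (δ : V → ℝ), Measurable f → (∃ B, ∀ σ, |f σ| ≤ B) →
        DependsOn f (win c : Set V) → (∀ x, 0 ≤ δ x) →
        (∀ (x : V) (σ τ : V → S), (∀ v, v ≠ x → σ v = τ v) → |f σ - f τ| ≤ δ x * r (σ x) (τ x)) →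
          |∫ σ, f σ ∂(γ (win c) ω) - ∫ σ, f σ ∂(γ (win c) η)| ≤
            (∑ x ∈ win c, K c y x * δ x) * r (ω y) (η y))
    (hloc : ∀ (c : V) (ζ ζ' : V → S), (∀ v ∈ nbhd c, ζ v = ζ' v) →
      ∀ (f : (V → S) → ℝ), Measurable f → (∃ B, ∀ σ, |f σ| ≤ B) → DependsOn f (win c : Set V) →
        ∫ σ, f σ ∂(γ (win c) ζ) = ∫ σ, f σ ∂(γ (win c) ζ'))
    {γ₀ : ℝ} (hγ₀ : 0 ≤ γ₀) (hγ₁ : γ₀ < 1)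
    (hsum : ∀ c, ∀ x ∈ win c, ∑ y ∈ nbhd c, K c y x ≤ γ₀)
    {Nstar : ℕ} (hN : ∀ (x : V) (G : Finset V), (G.filter fun c => x ∈ win c).card ≤ Nstar)
    (Λ : Finset V) (ω η : V → S) (ℓ : V → ℕ) (L₀ : ℕ)
    (hU : ∀ x, ℓ x ≠ 0 → ∀ c, x ∈ win c → c ∈ Λ ∧ nbhd c ⊆ Λ)
    (hℓ : ∀ c x y, x ∈ win c → K c y x ≠ 0 → ℓ x ≤ ℓ y + 1)
    {F : (V → S) → ℝ} (hFm : Measurable F) {B : ℝ} (hB : ∀ σ, |F σ| ≤ B)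
    (hFdep : DependsOn F (Λ : Set V)) {δ : V → ℝ} (hδ : IsLipBound r F δ)
    (hδL : ∀ x, ℓ x < L₀ → δ x = 0) :
    |∫ σ, F σ ∂(γ Λ ω) - ∫ σ, F σ ∂(γ Λ η)| ≤
      2 * R * Real.exp (-((1 - γ₀) ^ 2 / (2 * (2 * γ₀ * Nstar + 1)) * L₀)) * ∑ x ∈ Λ, δ x := by
  classical
  haveI := hγ.isProbability Λ ω
  haveI := hγ.isProbability Λ η
  -- extension of a vector on the cell type `↥Λ` by zero
  let ext : (↥Λ → ℝ) → V → ℝ := fun δ' v => if h : v ∈ Λ then δ' ⟨v, h⟩ else 0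
  have ext_apply : ∀ (δ' : ↥Λ → ℝ) (x : ↥Λ), ext δ' x.1 = δ' x := fun δ' x => by
    simp only [ext, dif_pos x.2]
  have ext_of_not_mem : ∀ (δ' : ↥Λ → ℝ) {v : V}, v ∉ Λ → ext δ' v = 0 := fun δ' v hv => by
    simp only [ext, dif_neg hv]
  -- admissible observables, Lipschitz vectors, window operators on `↥Λ`
  set Adm : ((V → S) → ℝ) → Prop := fun G =>
    Measurable G ∧ (∃ B, ∀ σ, |G σ| ≤ B) ∧ DependsOn G (Λ : Set V) with hAdm
  set Lip : ((V → S) → ℝ) → (↥Λ → ℝ) → Prop := fun G δ' => (∀ x, 0 ≤ δ' x) ∧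
    ∀ (x : ↥Λ) (σ τ : V → S), (∀ v, v ≠ x.1 → σ v = τ v) → |G σ - G τ| ≤ δ' x * r (σ x.1) (τ x.1)
    with hLip
  -- a Lipschitz vector on `↥Λ` of a `Λ`-local observable is a site-Lipschitz bound on `V`
  have lipV : ∀ {G : (V → S) → ℝ} {δ' : ↥Λ → ℝ}, Adm G → Lip G δ' → IsLipBound r G (ext δ') := by
    rintro G δ' ⟨-, -, hGdep⟩ ⟨hδ'0, hδ'⟩
    refine ⟨fun v => ?_, fun v σ τ hστ => ?_⟩
    · by_cases hv : v ∈ Λ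
      · rw [show ext δ' v = δ' ⟨v, hv⟩ from ext_apply δ' ⟨v, hv⟩]; exact hδ'0 _
      · rw [ext_of_not_mem δ' hv]
    · by_cases hv : v ∈ Λ
      · rw [show ext δ' v = δ' ⟨v, hv⟩ from ext_apply δ' ⟨v, hv⟩]
        exact hδ' ⟨v, hv⟩ σ τ hστ
      · rw [ext_of_not_mem δ' hv, zero_mul]
        rw [hGdep fun u hu => hστ u fun huv => hv (huv ▸ Finset.mem_coe.1 hu), sub_self, abs_zero]
  set T : ↥Λ → ((V → S) → ℝ) → ((V → S) → ℝ) := fun c G =>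
    if nbhd c.1 ⊆ Λ then fun σ => ∫ τ, G τ ∂(γ (win c.1) (Λ.piecewise σ ω))
    else fun σ => G (Function.update σ c.1 (ω c.1)) with hT
  set win' : ↥Λ → Finset ↥Λ := fun c =>
    if nbhd c.1 ⊆ Λ then (win c.1).subtype (· ∈ Λ) else {c} with hwin'
  set k' : ↥Λ → ↥Λ → ↥Λ → ℝ := fun c y x => if nbhd c.1 ⊆ Λ then K c.1 y.1 x.1 else 0 with hk'
  set U : Finset ↥Λ := Finset.univ.filter fun c => nbhd c.1 ⊆ Λ with hUdef
  -- membership in the two kinds of windows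
  have mem_win'_gen : ∀ {c x : ↥Λ}, nbhd c.1 ⊆ Λ → (x ∈ win' c ↔ x.1 ∈ win c.1) :=
    fun {c x} hc => by simp only [hwin', if_pos hc, Finset.mem_subtype]
  have mem_win'_frz : ∀ {c x : ↥Λ}, ¬ nbhd c.1 ⊆ Λ → (x ∈ win' c ↔ x = c) :=
    fun {c x} hc => by simp only [hwin', if_neg hc, Finset.mem_singleton]
  have mem_win_of_mem_win' : ∀ {c x : ↥Λ}, x ∈ win' c → x.1 ∈ win c.1 := fun {c x} hx => by
    by_cases hc : nbhd c.1 ⊆ Λ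
    · exact (mem_win'_gen hc).1 hx
    · rw [(mem_win'_frz hc).1 hx]; exact hself _
  -- (hlip0)
  have hlip0 : ∀ ⦃G : (V → S) → ℝ⦄ ⦃δ' : ↥Λ → ℝ⦄, Lip G δ' → ∀ x, 0 ≤ δ' x := fun G δ' h => h.1
  -- (hosc) interpolation on the sites of `Λ`
  have hoscA : ∀ ⦃G : (V → S) → ℝ⦄ ⦃δ' : ↥Λ → ℝ⦄, Adm G → Lip G δ' →
      ∀ σ τ, |G σ - G τ| ≤ R * ∑ x, δ' x := by
    intro G δ' hG hδ' σ τ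
    have h := abs_sub_le_mul_sum_of_dependsOn hrR hG.2.2 (lipV hG hδ') σ τ
    have hs : ∑ y ∈ Λ, ext δ' y = ∑ x : ↥Λ, δ' x := by
      rw [← Finset.sum_coe_sort]
      exact Finset.sum_congr rfl fun x _ => ext_apply δ' x
    rwa [hs] at h
  -- (hk)
  have hk : ∀ c y x, 0 ≤ k' c y x := fun c y x => by
    simp only [hk']; split_ifs; exacts [hK0 _ _ _, le_rfl]
  -- (hT) the window operators preserve admissibility
  have hTA : ∀ ⦃G : (V → S) → ℝ⦄ (c : ↥Λ), Adm G → Adm (T c G) := by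
    rintro G c ⟨hGm, ⟨B', hB'⟩, hGdep⟩
    by_cases hc : nbhd c.1 ⊆ Λ
    · simp only [hT, if_pos hc]
      refine ⟨(measurable_windowAvg' hγ (win c.1) hGm).comp (measurable_piecewise_conf Λ ω),
        ⟨B', fun σ => abs_windowAvg_le' hγ (win c.1) hB' _⟩, fun σ σ' hσ => ?_⟩
      have : Λ.piecewise σ ω = Λ.piecewise σ' ω := by
        funext v
        by_cases hv : v ∈ Λ
        · rw [Finset.piecewise_eq_of_mem _ _ _ hv, Finset.piecewise_eq_of_mem _ _ _ hv]
          exact hσ v (Finset.mem_coe.2 hv)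
        · rw [Finset.piecewise_eq_of_notMem _ _ _ hv, Finset.piecewise_eq_of_notMem _ _ _ hv]
      simp only [this]
    · simp only [hT, if_neg hc]
      refine ⟨hGm.comp (measurable_update_const' c.1 (ω c.1)), ⟨B', fun σ => hB' _⟩,
        fun σ σ' hσ => hGdep fun v hv => ?_⟩
      by_cases hvc : v = c.1
      · subst hvc; simp
      · rw [Function.update_of_ne hvc, Function.update_of_ne hvc]; exact hσ v hv
  -- (hdust) the window dusting estimate
  have hdust : ∀ ⦃G : (V → S) → ℝ⦄ ⦃δ' : ↥Λ → ℝ⦄ (c : ↥Λ), Adm G → Lip G δ' →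
      Lip (T c G) fun y => if y ∈ win' c then 0 else δ' y + ∑ x ∈ win' c, k' c y x * δ' x := by
    intro G δ' c hG hδ'
    have hGV := lipV hG hδ'
    obtain ⟨hGm, ⟨B', hB'⟩, hGdep⟩ := hG
    refine ⟨fun y => ?_, fun y σ τ hστ => ?_⟩
    · dsimp only
      split_ifs
      · exact le_rfl
      · exact add_nonneg (hδ'.1 y) (Finset.sum_nonneg fun x _ => mul_nonneg (hk c y x) (hδ'.1 x))
    by_cases hc : nbhd c.1 ⊆ Λ
    · -- a genuine window: the tree's window dusting estimate with the exterior frozen to `ω`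
      have hwinΛ : win c.1 ⊆ Λ := (hwin c.1).trans hc
      have hωη : ∀ v, id v ≠ y.1 → Λ.piecewise σ ω v = Λ.piecewise τ ω v := fun v hv => by
        by_cases hvΛ : v ∈ Λ
        · rw [Finset.piecewise_eq_of_mem _ _ _ hvΛ, Finset.piecewise_eq_of_mem _ _ _ hvΛ]
          exact hστ v hv
        · rw [Finset.piecewise_eq_of_notMem _ _ _ hvΛ, Finset.piecewise_eq_of_notMem _ _ _ hvΛ]
      have key := lip_windowAvg (ι := V) (cell := id) (w := fun x σ τ => r (σ x) (τ x)) hγ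
        (fun x σ σ' τ τ' hσ hτ => by simp only [hσ x rfl, hτ x rfl])
        (Λ := win c.1) (W := win c.1) (fun v => Iff.rfl) (kc := K c.1) (hcontract c.1) hGm hB'
        hGV.nonneg hGV.le y.1 (Λ.piecewise σ ω) (Λ.piecewise τ ω) hωη
      have hry : r (Λ.piecewise σ ω y.1) (Λ.piecewise τ ω y.1) = r (σ y.1) (τ y.1) := by
        rw [Finset.piecewise_eq_of_mem _ _ _ y.2, Finset.piecewise_eq_of_mem _ _ _ y.2]
      have hsumeq : ∑ x ∈ win c.1, K c.1 y.1 x * ext δ' x = ∑ x ∈ win' c, k' c y x * δ' x := by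
        simp only [hwin', hk', if_pos hc]
        rw [← Finset.sum_subtype_of_mem (f := fun x => K c.1 y.1 x * ext δ' x) fun x hx => hwinΛ hx]
        exact Finset.sum_congr rfl fun x _ => by rw [ext_apply]
      have hmem : (y.1 ∈ win c.1) ↔ (y ∈ win' c) := (mem_win'_gen hc).symm
      simp only [hT, if_pos hc]
      rw [hry, hsumeq, ext_apply] at key
      simp only [hmem] at key
      exact key
    · -- a frozen centre: the operator freezes the site `c`, its window is `{c}`, its array is `0`
      simp only [hT, if_neg hc]
      by_cases hyc : y = c
      · subst hyc
        have : Function.update σ y.1 (ω y.1) = Function.update τ y.1 (ω y.1) := by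
          funext v
          by_cases hv : v = y.1
          · subst hv; simp
          · rw [Function.update_of_ne hv, Function.update_of_ne hv]; exact hστ v hv
        rw [this, sub_self, abs_zero]
        exact mul_nonneg (by
          split_ifs
          · exact le_rfl
          · exact add_nonneg (hδ'.1 y)
              (Finset.sum_nonneg fun x _ => mul_nonneg (hk y y x) (hδ'.1 x))) (hr0 _ _)
      · have hy1 : y.1 ≠ c.1 := fun h => hyc (Subtype.ext h)
        have h := hδ'.2 y (Function.update σ c.1 (ω c.1)) (Function.update τ c.1 (ω c.1))
          fun v hv => by
            by_cases hvc : v = c.1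
            · subst hvc; simp
            · rw [Function.update_of_ne hvc, Function.update_of_ne hvc]; exact hστ v hv
        rw [Function.update_of_ne hy1, Function.update_of_ne hy1] at h
        refine h.trans (mul_le_mul_of_nonneg_right ?_ (hr0 _ _))
        rw [if_neg (fun h' => hyc ((mem_win'_frz hc).1 h'))]
        simp only [hk', if_neg hc, zero_mul, Finset.sum_const_zero, add_zero, le_refl]
  -- the functionals are monotone-normalised
  have hle : ∀ (ζ : V → S) ⦃G : (V → S) → ℝ⦄ ⦃M : ℝ⦄, Adm G → (∀ σ, G σ ≤ M) →
      ∫ σ, G σ ∂(γ Λ ζ) ≤ M := by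
    rintro ζ G M ⟨hGm, ⟨B', hB'⟩, -⟩ hM
    haveI := hγ.isProbability Λ ζ
    calc ∫ σ, G σ ∂(γ Λ ζ) ≤ ∫ _σ, M ∂(γ Λ ζ) :=
          integral_mono (integrable_of_abs_le' hGm hB') (integrable_const M) hM
      _ = M := by simp
  have hge : ∀ (ζ : V → S) ⦃G : (V → S) → ℝ⦄ ⦃M : ℝ⦄, Adm G → (∀ σ, M ≤ G σ) →
      M ≤ ∫ σ, G σ ∂(γ Λ ζ) := by
    rintro ζ G M ⟨hGm, ⟨B', hB'⟩, -⟩ hM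
    haveI := hγ.isProbability Λ ζ
    calc M = ∫ _σ, M ∂(γ Λ ζ) := by simp
      _ ≤ ∫ σ, G σ ∂(γ Λ ζ) := integral_mono (integrable_const M) (integrable_of_abs_le' hGm hB') hM
  -- a genuine window operator IS the window kernel on admissible observables (locality)
  have hTgen : ∀ ⦃G : (V → S) → ℝ⦄ (c : ↥Λ), nbhd c.1 ⊆ Λ → Adm G →
      ∀ σ, T c G σ = ∫ τ, G τ ∂(γ (win c.1) σ) := by
    rintro G c hc ⟨hGm, ⟨B', hB'⟩, hGdep⟩ σ
    simp only [hT, if_pos hc]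
    exact windowAvg_congr_of_local hγ hc (hloc c.1) hGm hB' hGdep fun v hv =>
      Finset.piecewise_eq_of_mem _ _ _ hv
  -- hence both kernels are invariant under the genuine window operators (consistency)
  have hinv : ∀ (ζ : V → S) ⦃G : (V → S) → ℝ⦄ (c : ↥Λ), c ∈ U → Adm G →
      ∫ σ, T c G σ ∂(γ Λ ζ) = ∫ σ, G σ ∂(γ Λ ζ) := by
    intro ζ G c hc hG
    have hc' : nbhd c.1 ⊆ Λ := (Finset.mem_filter.1 hc).2
    have hTG := hTgen c hc' hG
    obtain ⟨hGm, ⟨B', hB'⟩, -⟩ := hG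
    haveI := hγ.isProbability Λ ζ
    simp_rw [hTG]
    exact hγ.integral_integral_consistent ((hwin c.1).trans hc') ζ (integrable_of_abs_le' hGm hB')
  -- profile hypotheses on `↥Λ`
  have hUι : ∀ x : ↥Λ, ℓ x.1 ≠ 0 → ∀ c : ↥Λ, x ∈ win' c → c ∈ U := by
    intro x hx c hxc
    refine Finset.mem_filter.2 ⟨Finset.mem_univ _, ?_⟩
    by_cases hc : nbhd c.1 ⊆ Λ
    · exact hc
    · rw [(mem_win'_frz hc).1 hxc] at hx
      exact (hU c.1 hx c.1 (hself c.1)).2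
  have hℓι : ∀ c x y : ↥Λ, x ∈ win' c → k' c y x ≠ 0 → ℓ x.1 ≤ ℓ y.1 + 1 := by
    intro c x y hxc hkc
    by_cases hc : nbhd c.1 ⊆ Λ
    · simp only [hk', if_pos hc] at hkc
      exact hℓ c.1 x.1 y.1 ((mem_win'_gen hc).1 hxc) hkc
    · simp only [hk', if_neg hc, ne_eq, not_true_eq_false] at hkc
  -- (hsum) received sums on `↥Λ`: genuine windows contribute `≤ γ₀`, frozen centres contribute `0`
  have hsumι : ∀ x : ↥Λ, ∑ c ∈ Finset.univ.filter (fun c => x ∈ win' c), ∑ y, k' c y x ≤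
      γ₀ * (Finset.univ.filter fun c => x ∈ win' c).card := by
    intro x
    have hterm : ∀ c ∈ Finset.univ.filter (fun c => x ∈ win' c), ∑ y, k' c y x ≤ γ₀ := by
      intro c hc
      have hxc := (Finset.mem_filter.1 hc).2
      by_cases hgen : nbhd c.1 ⊆ Λ
      · simp only [hk', if_pos hgen]
        have h1 : ∑ y : ↥Λ, K c.1 y.1 x.1 = ∑ y ∈ Λ, K c.1 y x.1 :=
          Finset.sum_coe_sort Λ (fun y => K c.1 y x.1)
        have h2 : ∑ y ∈ Λ, K c.1 y x.1 = ∑ y ∈ nbhd c.1, K c.1 y x.1 := by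
          refine (Finset.sum_subset hgen fun y _ hy => ?_).symm
          by_contra h
          exact hy (hKsupp _ _ _ h)
        rw [h1, h2]
        exact hsum c.1 x.1 ((mem_win'_gen hgen).1 hxc)
      · simp only [hk', if_neg hgen, Finset.sum_const_zero]
        exact hγ₀
    calc ∑ c ∈ Finset.univ.filter (fun c => x ∈ win' c), ∑ y, k' c y x
        ≤ ∑ _c ∈ Finset.univ.filter (fun c => x ∈ win' c), γ₀ := Finset.sum_le_sum hterm
      _ = γ₀ * (Finset.univ.filter fun c => x ∈ win' c).card := by
          rw [Finset.sum_const, nsmul_eq_mul, mul_comm]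
  -- (hN) at most `N⋆` windows of `↥Λ` around a site
  have hNι : ∀ x : ↥Λ, (Finset.univ.filter fun c => x ∈ win' c).card ≤ Nstar := by
    intro x
    refine le_trans ?_ (hN x.1 Λ)
    refine Finset.card_le_card_of_injOn (fun c : ↥Λ => c.1) (fun c hc => ?_) ?_
    · exact Finset.mem_filter.2 ⟨c.2, mem_win_of_mem_win' (Finset.mem_filter.1 hc).2⟩
    · intro a _ b _ h
      exact Subtype.ext h
  have hselfι : ∀ x : ↥Λ, x ∈ win' x := fun x => by
    by_cases hc : nbhd x.1 ⊆ Λ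
    · exact (mem_win'_gen hc).2 (hself x.1)
    · exact (mem_win'_frz hc).2 rfl
  -- the data of `F`
  have hFA : Adm F := ⟨hFm, ⟨B, hB⟩, hFdep⟩
  have hδι : Lip F fun x : ↥Λ => δ x.1 :=
    ⟨fun x => hδ.nonneg x.1, fun x σ τ hστ => hδ.le x.1 σ τ hστ⟩
  have hδ0ι : ∀ x : ↥Λ, ℓ x.1 < L₀ → (fun x : ↥Λ => δ x.1) x = 0 := fun x hx => hδL x.1 hx
  -- the finite-cell window comparison theorem
  have key := abs_sub_le_exp (ι := ↥Λ) (Ω := V → S) (Adm := Adm) (Lip := Lip) (T := T)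
    (win := win') (k := k') (U := U) (E₁ := fun G => ∫ σ, G σ ∂(γ Λ ω))
    (E₂ := fun G => ∫ σ, G σ ∂(γ Λ η)) hR hlip0 hoscA hk hTA hdust (hle ω) (hge ω)
    (fun G c hc hG => hinv ω c hc hG) (hle η) (hge η) (fun G c hc hG => hinv η c hc hG) hγ₀ hγ₁
    (Nstar := Nstar) (fun x : ↥Λ => ℓ x.1) hUι hℓι hsumι hNι hselfι L₀ hFA hδι hδ0ι
  have hs : ∑ x : ↥Λ, δ x.1 = ∑ x ∈ Λ, δ x := Finset.sum_coe_sort Λ δ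
  rw [hs] at key
  exact key

/-! ### Uniqueness of the Gibbs measure -/

/-- **Two Gibbs measures agree on bounded local Lipschitz observables under the window condition**
(Dobrushin–Shlosman 1985, Thm. 1, Vasserstein form; the DLR equations turn `μ F − ν F` into a double average
of `γ_Λ F(ω) − γ_Λ F(η)`, which `abs_integral_sub_integral_le_of_window` bounds by `2 R e^{−κ₁ L₀} Σ δ` for
every depth `L₀` along an exhaustion of `V` by volumes carrying adapted profiles).
[cite: DobrushinShlosman1985, Theorem 1] -/
theorem integral_eq_integral_of_window [DecidableEq V] {γ : Specification V S} (hγ : IsSpecification γ)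
    {r : S → S → ℝ} {R : ℝ} (hr0 : ∀ a b, 0 ≤ r a b) (hrR : ∀ a b, r a b ≤ R) (hR : 0 ≤ R)
    {win nbhd : V → Finset V} {K : V → V → V → ℝ} (hK0 : ∀ c y x, 0 ≤ K c y x)
    (hself : ∀ c, c ∈ win c) (hwin : ∀ c, win c ⊆ nbhd c)
    (hKsupp : ∀ c y x, K c y x ≠ 0 → y ∈ nbhd c)
    (hcontract : ∀ (c y : V), y ∉ win c → ∀ (ω η : V → S), (∀ v, v ≠ y → ω v = η v) →
      ∀ (f : (V → S) → ℝ) (δ : V → ℝ), Measurable f → (∃ B, ∀ σ, |f σ| ≤ B) →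
        DependsOn f (win c : Set V) → (∀ x, 0 ≤ δ x) →
        (∀ (x : V) (σ τ : V → S), (∀ v, v ≠ x → σ v = τ v) → |f σ - f τ| ≤ δ x * r (σ x) (τ x)) →
          |∫ σ, f σ ∂(γ (win c) ω) - ∫ σ, f σ ∂(γ (win c) η)| ≤
            (∑ x ∈ win c, K c y x * δ x) * r (ω y) (η y))
    (hloc : ∀ (c : V) (ζ ζ' : V → S), (∀ v ∈ nbhd c, ζ v = ζ' v) →
      ∀ (f : (V → S) → ℝ), Measurable f → (∃ B, ∀ σ, |f σ| ≤ B) → DependsOn f (win c : Set V) →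
        ∫ σ, f σ ∂(γ (win c) ζ) = ∫ σ, f σ ∂(γ (win c) ζ'))
    {γ₀ : ℝ} (hγ₀ : 0 ≤ γ₀) (hγ₁ : γ₀ < 1)
    (hsum : ∀ c, ∀ x ∈ win c, ∑ y ∈ nbhd c, K c y x ≤ γ₀)
    {Nstar : ℕ} (hN : ∀ (x : V) (G : Finset V), (G.filter fun c => x ∈ win c).card ≤ Nstar)
    (hexh : ∀ (Δ : Finset V) (L₀ : ℕ), ∃ (Λ : Finset V) (ℓ : V → ℕ), Δ ⊆ Λ ∧
      (∀ x, ℓ x ≠ 0 → ∀ c, x ∈ win c → c ∈ Λ ∧ nbhd c ⊆ Λ) ∧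
      (∀ c x y, x ∈ win c → K c y x ≠ 0 → ℓ x ≤ ℓ y + 1) ∧ (∀ x ∈ Δ, L₀ ≤ ℓ x))
    {μ ν : Measure (V → S)} (hμ : IsGibbsMeasure γ μ) (hν : IsGibbsMeasure γ ν)
    {F : (V → S) → ℝ} (hFm : Measurable F) {B : ℝ} (hB : ∀ σ, |F σ| ≤ B) {Δ : Finset V}
    (hFdep : DependsOn F (Δ : Set V)) {δ : V → ℝ} (hδ : IsLipBound r F δ) :
    ∫ σ, F σ ∂μ = ∫ σ, F σ ∂ν := by
  classical
  haveI := hμ.isProbabilityMeasure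
  haveI := hν.isProbabilityMeasure
  set κ₁ : ℝ := (1 - γ₀) ^ 2 / (2 * (2 * γ₀ * Nstar + 1)) with hκ₁
  have hκ₁pos : 0 < κ₁ := by
    have h1 : 0 < 1 - γ₀ := sub_pos.2 hγ₁
    rw [hκ₁]; positivity
  -- the Lipschitz vector cut down to `Δ`
  set δΔ : V → ℝ := fun x => if x ∈ Δ then δ x else 0 with hδΔ
  have hδΔ' : IsLipBound r F δΔ := hδ.restrict hFdep
  set SΔ : ℝ := ∑ x ∈ Δ, δ x with hSΔ
  -- the bound at every depth
  have step : ∀ L₀ : ℕ, |∫ σ, F σ ∂μ - ∫ σ, F σ ∂ν| ≤ 2 * R * Real.exp (-(κ₁ * L₀)) * SΔ := by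
    intro L₀
    obtain ⟨Λ, ℓ, hΔΛ, hUΛ, hℓΛ, hLΛ⟩ := hexh Δ L₀
    have hFdepΛ : DependsOn F (Λ : Set V) :=
      hFdep.mono fun v hv => Finset.mem_coe.2 (hΔΛ (Finset.mem_coe.1 hv))
    have hδL : ∀ x, ℓ x < L₀ → δΔ x = 0 := fun x hx => by
      simp only [hδΔ]
      split_ifs with hxΔ
      · exact absurd (hLΛ x hxΔ) (not_le.2 hx)
      · rfl
    -- the two-boundary-condition bound, for every pair of boundary conditions
    have hpair : ∀ ω η : V → S, |∫ σ, F σ ∂(γ Λ ω) - ∫ σ, F σ ∂(γ Λ η)| ≤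
        2 * R * Real.exp (-(κ₁ * L₀)) * SΔ := by
      intro ω η
      have h := abs_integral_sub_integral_le_of_window hγ hr0 hrR hR hK0 hself hwin hKsupp hcontract
        hloc hγ₀ hγ₁ hsum hN Λ ω η ℓ L₀ hUΛ hℓΛ hFm hB hFdepΛ hδΔ' hδL
      have hs : ∑ x ∈ Λ, δΔ x = SΔ := by
        rw [hSΔ, hδΔ, Finset.sum_ite_mem, Finset.inter_eq_right.2 hΔΛ]
      rwa [hs] at h
    -- DLR: `μ F = ∫ γ_Λ F dμ`, `ν F = ∫ γ_Λ F dν`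
    rw [← hμ.integral_integral_eq hγ Λ (integrable_of_abs_le' hFm hB),
      ← hν.integral_integral_eq hγ Λ (integrable_of_abs_le' hFm hB)]
    exact abs_integral_sub_integral_le_of_osc' (measurable_windowAvg' hγ Λ hFm)
      (fun σ => abs_windowAvg_le' hγ Λ hB σ) hpair
  -- let the depth tend to infinity
  have hlim : Filter.Tendsto (fun L₀ : ℕ => 2 * R * Real.exp (-(κ₁ * L₀)) * SΔ) Filter.atTop
      (nhds (2 * R * 0 * SΔ)) := by
    refine ((tendsto_const_nhds.mul ?_).mul tendsto_const_nhds)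
    have h1 : Filter.Tendsto (fun L₀ : ℕ => κ₁ * (L₀ : ℝ)) Filter.atTop Filter.atTop :=
      Filter.Tendsto.const_mul_atTop hκ₁pos tendsto_natCast_atTop_atTop
    exact Real.tendsto_exp_neg_atTop_nhds_zero.comp h1
  rw [mul_zero, zero_mul] at hlim
  have h0 : |∫ σ, F σ ∂μ - ∫ σ, F σ ∂ν| ≤ 0 :=
    ge_of_tendsto hlim (Filter.Eventually.of_forall step)
  have := abs_nonneg (∫ σ, F σ ∂μ - ∫ σ, F σ ∂ν)
  exact sub_eq_zero.1 (abs_eq_zero.1 (le_antisymm h0 this))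

section Determine

variable {M : Type*} [PseudoMetricSpace M] [MeasurableSpace M] [BorelSpace M]

/-- **Dobrushin–Shlosman's uniqueness theorem, Vasserstein form, arbitrary index set** (Dobrushin–Shlosman
1985, Thm. 1: the window condition `C_V` implies that the specification has exactly one Gibbs field; here: AT
MOST one, for an arbitrary measurable spin space whose σ-algebra is induced by a map `val` into a metric space
with `dist ∘ val ≤ A · r`, so that local `r`-Lipschitz observables determine probability measures,
`DobrushinMetric.measure_eq_of_forall_integral_eq_of_isLipBound`). Hypotheses as in
`integral_eq_integral_of_window`. [cite: DobrushinShlosman1985, Theorem 1] -/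
theorem subsingleton_gibbsMeasures_of_window [DecidableEq V] {γ : Specification V S}
    (hγ : IsSpecification γ)
    {r : S → S → ℝ} {R : ℝ} (hr0 : ∀ a b, 0 ≤ r a b) (hrR : ∀ a b, r a b ≤ R) (hR : 0 ≤ R)
    {win nbhd : V → Finset V} {K : V → V → V → ℝ} (hK0 : ∀ c y x, 0 ≤ K c y x)
    (hself : ∀ c, c ∈ win c) (hwin : ∀ c, win c ⊆ nbhd c)
    (hKsupp : ∀ c y x, K c y x ≠ 0 → y ∈ nbhd c)
    (hcontract : ∀ (c y : V), y ∉ win c → ∀ (ω η : V → S), (∀ v, v ≠ y → ω v = η v) →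
      ∀ (f : (V → S) → ℝ) (δ : V → ℝ), Measurable f → (∃ B, ∀ σ, |f σ| ≤ B) →
        DependsOn f (win c : Set V) → (∀ x, 0 ≤ δ x) →
        (∀ (x : V) (σ τ : V → S), (∀ v, v ≠ x → σ v = τ v) → |f σ - f τ| ≤ δ x * r (σ x) (τ x)) →
          |∫ σ, f σ ∂(γ (win c) ω) - ∫ σ, f σ ∂(γ (win c) η)| ≤
            (∑ x ∈ win c, K c y x * δ x) * r (ω y) (η y))
    (hloc : ∀ (c : V) (ζ ζ' : V → S), (∀ v ∈ nbhd c, ζ v = ζ' v) →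
      ∀ (f : (V → S) → ℝ), Measurable f → (∃ B, ∀ σ, |f σ| ≤ B) → DependsOn f (win c : Set V) →
        ∫ σ, f σ ∂(γ (win c) ζ) = ∫ σ, f σ ∂(γ (win c) ζ'))
    {γ₀ : ℝ} (hγ₀ : 0 ≤ γ₀) (hγ₁ : γ₀ < 1)
    (hsum : ∀ c, ∀ x ∈ win c, ∑ y ∈ nbhd c, K c y x ≤ γ₀)
    {Nstar : ℕ} (hN : ∀ (x : V) (G : Finset V), (G.filter fun c => x ∈ win c).card ≤ Nstar)
    (hexh : ∀ (Δ : Finset V) (L₀ : ℕ), ∃ (Λ : Finset V) (ℓ : V → ℕ), Δ ⊆ Λ ∧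
      (∀ x, ℓ x ≠ 0 → ∀ c, x ∈ win c → c ∈ Λ ∧ nbhd c ⊆ Λ) ∧
      (∀ c x y, x ∈ win c → K c y x ≠ 0 → ℓ x ≤ ℓ y + 1) ∧ (∀ x ∈ Δ, L₀ ≤ ℓ x))
    (val : S → M) (hS : ‹MeasurableSpace S› = MeasurableSpace.comap val ‹MeasurableSpace M›)
    {A : ℝ} (hA0 : 0 ≤ A) (hA : ∀ a b, dist (val a) (val b) ≤ A * r a b) :
    (gibbsMeasures γ).Subsingleton := by
  classical
  intro μ hμ ν hν
  haveI := IsGibbsMeasure.isProbabilityMeasure hμ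
  haveI := IsGibbsMeasure.isProbabilityMeasure hν
  refine measure_eq_of_forall_integral_eq_of_isLipBound val hS fun f Δ δ hfm hdep hf1 hδ => ?_
  -- an `A δ`-Lipschitz bound for the weight `r` (adapted from
  -- `DobrushinMetric.subsingleton_gibbsMeasures_of_isKRContraction`)
  have hδ' : IsLipBound r f fun y => A * δ y :=
    ⟨fun y => mul_nonneg hA0 (hδ.nonneg y), fun y σ τ hστ =>
      (hδ.le y σ τ hστ).trans (by
        calc δ y * dist (val (σ y)) (val (τ y)) ≤ δ y * (A * r (σ y) (τ y)) :=
              mul_le_mul_of_nonneg_left (hA _ _) (hδ.nonneg y)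
          _ = A * δ y * r (σ y) (τ y) := by ring)⟩
  exact integral_eq_integral_of_window hγ hr0 hrR hR hK0 hself hwin hKsupp hcontract hloc hγ₀ hγ₁ hsum
    hN hexh hμ hν hfm hf1 hdep hδ'

end Determine

end Literature.Probability.LatticeModels.DobrushinShlosman

end
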